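import Summits.HodgeConjecture.HodgeConjecture.Theorems.AnchorTransportVariationalHodgePadicGenericPropagationQP
import Summits.HodgeConjecture.HodgeConjecture.Theorems.AnchorTransportVariationalHodgeCurveBase
import Summits.HodgeConjecture.HodgeConjecture.Theorems.Ring2BindersVariationalHodgeQP
import Literature.AlgebraicGeometry.Motives.CurveThroughTwoPointsProofs
import Literature.AlgebraicGeometry.Crystalline.BlochEsnaultKerzLifting

/-!
# Route AnchorTransport — crux `VariationalHodge` (stmt-HodgeConjecture-1076), line `padic-disc-transport`:
# the composition on QUASI-PROJECTIVE carriers — `P ∧ S ⟹ VariationalHodgeQP`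

HONEST FRAMING: research route conditional on HC_CM; not a corollary; Q11.4-sentence-2 already refuted in dim ≥ 3.
Helper file on the crux item (nothing here closes it; no definition, no named fact, no `sorry`;
`HC_CM` does not occur). Cell `pub-hodge-ring2`, binder seat `ring2-b03` (gen 32), BINDER-OWNERS row b03.

With STUB D (`Theorems.curveResidual_of_variationalHodgeDescended`, gen 30) and STUB G for
quasi-projective total spaces (`Theorems.genericPropagation_of_isQuasiProjectiveOver`, gen 32) in the
kernel, the registered skeleton's composition `D → G → P → S → VariationalHodge` runs, on QUASI-PROJECTIVE
carriers, with only its two arithmetic stubs as hypotheses — the research bet P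
(`PadicDiscTransport.PadicImageAlgebraization`: the `K₀`-form of Antieau–Mathew–Morrow–Nikolaus 2022
Conj. 1.3 / Bloch–Esnault–Kerz 2014 Conj. 1.2, research-OPEN) and the arithmetic disc S
(`PadicDiscTransport.ArithmeticDiscSupply`, Maulik–Poonen pattern, classical, size XL), both copied
VERBATIM as hypotheses (the skeleton's local `def`s are not importable under `Theorems/`):

* `variationalHodgeDescendedQP_of_padic` — G_QP + P + S ⇒ the descended crux for quasi-projective
  complexified total spaces (the skeleton's `variationalHodgeDescended_of`, threading quasi-projectivity);
* `curveResidualQP_of_padic` — descent to a countable field (the proof of STUB D, gen 30, threading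
  quasi-projectivity along the isomorphism of families) ⇒ the crux over smooth irreducible affine curves for
  quasi-projective total spaces;
* `variationalHodge_projective_of_padic`, `variationalHodge_quasiProjective_of_padic` — hence the crux for
  projective families / quasi-projective total spaces over EVERY smooth irreducible base (the route's
  unconditional reductions `variationalHodge_projective_of_curveBase` with Mumford's curve lemma discharged,
  `variationalHodge_quasiProjective_of_projective`);
* `variationalHodgeQP_of_padic`, `flatSectionsAlgebraicQP_of_padic` — **the printed-carrier nodes of the
  cell's dictionary: `Ring2.Hypotheses.VariationalHodgeQP` (part XXVII) and Charles–Schnell's Conj. 11.3.1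
  verbatim `FlatSectionsAlgebraicQP` follow from P ∧ S.** A new edge for BINDER-OWNERS rows b03/b04 (their
  printed, quasi-projective forms): `⟸ {AMMN 2022 Conj. 1.3 (K₀-form), arithmetic disc}`; the unrestricted
  rows keep the route's `hqp` residual (Atiyah-type proper non-projective families).

References: [MaulikPoonen2012] §3–4; [AntieauMathewMorrowNikolaus2022] Conj. 1.3, Question 1.4, Thm. D;
[BlochEsnaultKerz2014pAdic] Conj. 1.2, Thm. 1.3; [CharlesSchnell2014Notes] Conj. 11.3.1, Prop. 11.3.11;
[EGAIV3] Thm. 8.8.2; [MumfordAV1970] §6 Lemma.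
-/

noncomputable section

-- every declaration of this problem lives in `Summit.HodgeConjecture.HodgeConjecture.…` (summit = sub-problem)
set_option linter.dupNamespace false

open CategoryTheory AlgebraicGeometry TopologicalSpace MonoidalCategory
open Literature.AlgebraicGeometry.Motives Literature.AlgebraicGeometry.HodgeTheory
open Literature.AlgebraicGeometry.KTheory Literature.AlgebraicGeometry.Crystalline
open Summit.HodgeConjecture.HodgeConjecture.Theses.AnchorTransport
open scoped Isocrystal

namespace Summit.HodgeConjecture.HodgeConjecture.Theorems

section Padic

-- Hypotheses P (`PadicDiscTransport.PadicImageAlgebraization`, with `ProClassAlgebraizes` unfolded) and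
-- S (`PadicDiscTransport.ArithmeticDiscSupply`, with `IsGenericPoint` / `ProClassAlgebraizes` unfolded) of the
-- registered skeleton, verbatim.
variable
  (hP : ∀ d : ℕ, ∃ p₀ : ℕ, ∀ (p : ℕ) [Fact p.Prime], p₀ ≤ p →
    ∀ (κ : Type) [Field κ] [CharP κ p] [PerfectRing κ p] [IsAlgClosed κ] [Algebra (ZMod p) κ],
    Algebra.IsAlgebraic (ZMod p) κ →
    ∀ (𝒴 : SchemeOver (WittVector p κ)), WittScheme.IsSmoothProperModel d 𝒴 →
    ∀ ξ : ContinuousKZeroRat (Ideal.span {(p : WittVector p κ)}) 𝒴,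
      ∃ η : KZeroRat 𝒴.left,
        KZeroRat.map (WittScheme.specialFibreι 𝒴) η =
          KZeroRat.map (specialFibreToTower 𝒴)
            (ContinuousKZeroRat.specialFibre (Ideal.span {(p : WittVector p κ)}) 𝒴 ξ))
  (hS : ∀ (N : ℕ) (k : Type) [Field k] [Countable k] (σ : k →+* ℂ) ⦃n : ℕ⦄ ⦃𝒳₀ S₀ : SchemeOver k⦄
    (f₀ : 𝒳₀ ⟶ S₀),
    IsSmoothProjectiveFamily ((baseChangeHom σ).map f₀) n →
    IrreducibleSpace ((baseChangeHom σ).obj S₀).left → IsAffine ((baseChangeHom σ).obj S₀).left →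
    AlgebraicGeometry.Smooth ((baseChangeHom σ).obj S₀).hom →
    topologicalKrullDim ((baseChangeHom σ).obj S₀).left = 1 →
    ∀ (p : ℕ) (A : complexBetti ((baseChangeHom σ).obj 𝒳₀) (2 * p)),
    (∀ s : ComplexPoints ((baseChangeHom σ).obj S₀),
      IsRationalClass (complexBetti.map (fiberι ((baseChangeHom σ).map f₀) s) (2 * p) A) ∧
      IsOfHodgeType n (fiberOver ((baseChangeHom σ).map f₀) s) (2 * p) p p
        (complexBetti.map (fiberι ((baseChangeHom σ).map f₀) s) (2 * p) A)) →
    ∀ s₀ : ComplexPoints ((baseChangeHom σ).obj S₀),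
      complexBetti.map (fiberι ((baseChangeHom σ).map f₀) s₀) (2 * p) A ∈
        algebraicClasses (fiberOver ((baseChangeHom σ).map f₀) s₀) p →
    ∃ (q : ℕ) (_ : Fact q.Prime) (κ : Type) (_ : Field κ) (_ : CharP κ q) (_ : PerfectRing κ q)
      (_ : IsAlgClosed κ) (_ : Algebra (ZMod q) κ) (_ : Algebra.IsAlgebraic (ZMod q) κ)
      (𝒴 : SchemeOver (WittVector q κ))
      (ξ : ContinuousKZeroRat (Ideal.span {(q : WittVector q κ)}) 𝒴)
      (s : ComplexPoints ((baseChangeHom σ).obj S₀)) (ι : K(q, κ) →+* ℂ),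
      N ≤ q ∧ WittScheme.IsSmoothProperModel n 𝒴 ∧
      (∀ Z : Set (ComplexPoints ((baseChangeHom σ).obj S₀)),
        IsDefinedOver σ S₀ σ.fieldRange Z → s ∈ Z → Z = Set.univ) ∧
      Nonempty ((baseChangeHom ι).obj (WittScheme.genericFibre 𝒴) ≅
        fiberOver ((baseChangeHom σ).map f₀) s) ∧
      ((∃ η : KZeroRat 𝒴.left,
        KZeroRat.map (WittScheme.specialFibreι 𝒴) η =
          KZeroRat.map (specialFibreToTower 𝒴)
            (ContinuousKZeroRat.specialFibre (Ideal.span {(q : WittVector q κ)}) 𝒴 ξ)) →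
        complexBetti.map (fiberι ((baseChangeHom σ).map f₀) s) (2 * p) A ∈
          algebraicClasses (fiberOver ((baseChangeHom σ).map f₀) s) p))

include hP hS

/-- **G_QP + P + S ⟹ the descended crux on quasi-projective carriers** (the skeleton's
`variationalHodgeDescended_of`, with STUB G supplied by `genericPropagation_of_isQuasiProjectiveOver`):
take the bet's bound `p₀` for relative dimension `n`; the arithmetic disc supplies `q ≥ p₀`, a model `𝒴`,
a pro-class `ξ̂` and a `k`-generic point `s`; the bet algebraizes `ξ̂|_{Y_κ}`, so `A|_{X_s}` is algebraic;
propagation from the generic fibre (quasi-projective total space) gives every fibre.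
[cite: MaulikPoonen2012, §3–4] [cite: AntieauMathewMorrowNikolaus2022, Conj. 1.3 and Thm. D] -/
theorem variationalHodgeDescendedQP_of_padic (k : Type) [Field k] [Countable k] (σ : k →+* ℂ) ⦃n : ℕ⦄
    ⦃𝒳₀ S₀ : SchemeOver k⦄ (f₀ : 𝒳₀ ⟶ S₀)
    (hf : IsSmoothProjectiveFamily ((baseChangeHom σ).map f₀) n)
    (hirr : IrreducibleSpace ((baseChangeHom σ).obj S₀).left)
    (haff : IsAffine ((baseChangeHom σ).obj S₀).left)
    (hsm : AlgebraicGeometry.Smooth ((baseChangeHom σ).obj S₀).hom)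
    (hdim : topologicalKrullDim ((baseChangeHom σ).obj S₀).left = 1)
    (h𝒳 : IsQuasiProjectiveOver ((baseChangeHom σ).obj 𝒳₀))
    (p : ℕ) (A : complexBetti ((baseChangeHom σ).obj 𝒳₀) (2 * p))
    (hA : ∀ s : ComplexPoints ((baseChangeHom σ).obj S₀),
      IsRationalClass (complexBetti.map (fiberι ((baseChangeHom σ).map f₀) s) (2 * p) A) ∧
      IsOfHodgeType n (fiberOver ((baseChangeHom σ).map f₀) s) (2 * p) p p
        (complexBetti.map (fiberι ((baseChangeHom σ).map f₀) s) (2 * p) A))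
    (hs₀ : ∃ s₀ : ComplexPoints ((baseChangeHom σ).obj S₀),
      complexBetti.map (fiberι ((baseChangeHom σ).map f₀) s₀) (2 * p) A ∈
        algebraicClasses (fiberOver ((baseChangeHom σ).map f₀) s₀) p)
    (t : ComplexPoints ((baseChangeHom σ).obj S₀)) :
    complexBetti.map (fiberι ((baseChangeHom σ).map f₀) t) (2 * p) A ∈
      algebraicClasses (fiberOver ((baseChangeHom σ).map f₀) t) p := by
  obtain ⟨s₀, hs₀⟩ := hs₀
  obtain ⟨p₀, hp₀⟩ := hP n
  obtain ⟨q, hq, κ, hκF, hκC, hκP, hκA, hκAlg, hκalg, 𝒴, ξ, s, ι, hNq, h𝒴, hgen, -, himp⟩ :=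
    hS p₀ k σ f₀ hf hirr haff hsm hdim p A hA s₀ hs₀
  have halg : complexBetti.map (fiberι ((baseChangeHom σ).map f₀) s) (2 * p) A ∈
      algebraicClasses (fiberOver ((baseChangeHom σ).map f₀) s) p :=
    himp (hp₀ q hNq κ hκalg 𝒴 h𝒴 ξ)
  exact genericPropagation_of_isQuasiProjectiveOver k σ f₀ hf hirr haff hsm hdim h𝒳 p A s hgen halg t

/-- **P ∧ S ⟹ the crux over smooth irreducible affine CURVES for quasi-projective total spaces**
(STUB D's descent, `Limits.exists_countable_subfield_descent` — EGA IV₃ 8.8.2 (ii) — with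
quasi-projectivity of the total space carried along the isomorphism of families, then
`variationalHodgeDescendedQP_of_padic`). [cite: EGAIV3, Thm. 8.8.2 (ii)] [cite: MaulikPoonen2012, §3–4] -/
theorem curveResidualQP_of_padic ⦃n : ℕ⦄ ⦃𝒳 S : SchemeOver ℂ⦄ (f : 𝒳 ⟶ S)
    (hf : IsSmoothProjectiveFamily f n) (h𝒳 : IsQuasiProjectiveOver 𝒳)
    (hirr : IrreducibleSpace S.left) (haff : IsAffine S.left) (hsm : AlgebraicGeometry.Smooth S.hom)
    (hdim : topologicalKrullDim S.left = 1) (p : ℕ) (A : complexBetti 𝒳 (2 * p))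
    (hA : ∀ s : ComplexPoints S, IsRationalClass (complexBetti.map (fiberι f s) (2 * p) A) ∧
      IsOfHodgeType n (fiberOver f s) (2 * p) p p (complexBetti.map (fiberι f s) (2 * p) A))
    (hs₀ : ∃ s₀ : ComplexPoints S,
      complexBetti.map (fiberι f s₀) (2 * p) A ∈ algebraicClasses (fiberOver f s₀) p)
    (s : ComplexPoints S) :
    complexBetti.map (fiberι f s) (2 * p) A ∈ algebraicClasses (fiberOver f s) p := by
  obtain ⟨s₀, hs₀⟩ := hs₀
  haveI := hirr
  haveI := haff
  haveI := hsm
  -- instances for the descent: `S → Spec ℂ` affine of finite type, `f` proper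
  haveI : IsProper f.left := hf.isProper
  haveI : IsAffineHom S.hom := isAffineHom_of_isAffine S.hom
  haveI : IsSeparated S.hom := inferInstance
  haveI : QuasiCompact S.hom := inferInstance
  haveI : LocallyOfFiniteType S.hom := inferInstance
  -- (1) descent to a countable subfield
  obtain ⟨k, _, _, σ, 𝒳₀, S₀, f₀, e𝒳, eS, hcomm⟩ :=
    Literature.AlgebraicGeometry.Limits.exists_countable_subfield_descent f
  -- (2) transport of the hypotheses to `f₀ ⊗_σ ℂ`
  have hf' : IsSmoothProjectiveFamily ((baseChangeHom σ).map f₀) n :=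
    IsSmoothProjectiveFamily.of_arrowIso e𝒳 eS hcomm hf
  obtain ⟨hirr', haff', hsm', hdim'⟩ := base_hypotheses_of_iso (S' := (baseChangeHom σ).obj S₀) eS hdim
  have h𝒳' : IsQuasiProjectiveOver ((baseChangeHom σ).obj 𝒳₀) := isQuasiProjectiveOver_of_iso e𝒳 h𝒳
  have hA' := fibrewise_rational_hodgeType_of_arrowIso e𝒳 eS hcomm A hA
  have hs₀' : complexBetti.map (fiberι ((baseChangeHom σ).map f₀) (AlgPoints.map eS.inv s₀)) (2 * p)
      (complexBetti.map e𝒳.hom (2 * p) A) ∈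
        algebraicClasses (fiberOver ((baseChangeHom σ).map f₀) (AlgPoints.map eS.inv s₀)) p :=
    (map_fiberι_mem_algebraicClasses_iff_of_arrowIso e𝒳 eS hcomm A
      (AlgPoints.map_hom_map_inv_apply eS s₀)).mpr hs₀
  -- (3) the descended statement and transport of the conclusion back
  have h := variationalHodgeDescendedQP_of_padic hP hS k σ f₀ hf' hirr' haff' hsm' hdim' h𝒳' p
    (complexBetti.map e𝒳.hom (2 * p) A) hA' ⟨AlgPoints.map eS.inv s₀, hs₀'⟩ (AlgPoints.map eS.inv s)
  exact (map_fiberι_mem_algebraicClasses_iff_of_arrowIso e𝒳 eS hcomm A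
    (AlgPoints.map_hom_map_inv_apply eS s)).mp h

/-- **P ∧ S ⟹ the variational Hodge statement for PROJECTIVE smooth families over every smooth
irreducible base** (`f` a closed immersion into `ℙᴺ × S` followed by the projection): reduce to affine
curve bases (`variationalHodge_projective_of_curveBase`, Mumford's curve lemma discharged), where the
total space is quasi-projective. [cite: MumfordAV1970, §6 Lemma] [cite: CharlesSchnell2014Notes, Conj. 11.3.1] -/
theorem variationalHodge_projective_of_padic ⦃n : ℕ⦄ ⦃𝒳 S : SchemeOver ℂ⦄ (f : 𝒳 ⟶ S)
    (hf : IsSmoothProjectiveFamily f n)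
    (hι : ∃ (N : ℕ) (ι : 𝒳 ⟶ projectiveSpace N ℂ ⊗ S), IsClosedImmersion ι.left ∧
      ι ≫ CartesianMonoidalCategory.snd (projectiveSpace N ℂ) S = f)
    (hirr : IrreducibleSpace S.left) (hsm : AlgebraicGeometry.Smooth S.hom) (p : ℕ)
    (A : complexBetti 𝒳 (2 * p))
    (hA : ∀ s : ComplexPoints S, IsRationalClass (complexBetti.map (fiberι f s) (2 * p) A) ∧
      IsOfHodgeType n (fiberOver f s) (2 * p) p p (complexBetti.map (fiberι f s) (2 * p) A))
    (hs₀ : ∃ s₀ : ComplexPoints S,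
      complexBetti.map (fiberι f s₀) (2 * p) A ∈ algebraicClasses (fiberOver f s₀) p)
    (s : ComplexPoints S) :
    complexBetti.map (fiberι f s) (2 * p) A ∈ algebraicClasses (fiberOver f s) p :=
  variationalHodge_projective_of_curveBase mumford_smoothCurve_through_two_points_holds
    (fun _ _ S' f' hf' hι' hirr' haff' hsm' hdim' p' A' hA' hs₀' s' => by
      haveI := haff'
      haveI := hsm'
      exact curveResidualQP_of_padic hP hS f' hf' (isQuasiProjectiveOver_of_isClosedImmersion_of_isAffine hι')
        hirr' haff' hsm' hdim' p' A' hA' hs₀' s')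
    f hf hι hirr hsm p A hA hs₀ s

/-- **P ∧ S ⟹ the variational Hodge statement for QUASI-PROJECTIVE total spaces over every smooth
irreducible base** (`variationalHodge_quasiProjective_of_projective`: over an affine base a proper family
with quasi-projective total space and projective fibres is projective).
[cite: Hartshorne1977, Ch. II §4 (projective morphisms) and Cor. 4.8 (e)] [cite: CharlesSchnell2014Notes, Conj. 11.3.1] -/
theorem variationalHodge_quasiProjective_of_padic ⦃n : ℕ⦄ ⦃𝒳 S : SchemeOver ℂ⦄ (f : 𝒳 ⟶ S)
    (hf : IsSmoothProjectiveFamily f n) (h𝒳 : IsQuasiProjectiveOver 𝒳)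
    (hirr : IrreducibleSpace S.left) (hsm : AlgebraicGeometry.Smooth S.hom) (p : ℕ)
    (A : complexBetti 𝒳 (2 * p))
    (hA : ∀ s : ComplexPoints S, IsRationalClass (complexBetti.map (fiberι f s) (2 * p) A) ∧
      IsOfHodgeType n (fiberOver f s) (2 * p) p p (complexBetti.map (fiberι f s) (2 * p) A))
    (hs₀ : ∃ s₀ : ComplexPoints S,
      complexBetti.map (fiberι f s₀) (2 * p) A ∈ algebraicClasses (fiberOver f s₀) p)
    (s : ComplexPoints S) :
    complexBetti.map (fiberι f s) (2 * p) A ∈ algebraicClasses (fiberOver f s) p :=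
  variationalHodge_quasiProjective_of_projective
    (fun _ _ _ f' hf' hι' hirr' _ hsm' p' A' hA' hs₀' s' =>
      variationalHodge_projective_of_padic hP hS f' hf' hι' hirr' hsm' p' A' hA' hs₀' s')
    f hf h𝒳 hirr hsm p A hA hs₀ s

/-- **P ∧ S ⟹ `Ring2.Hypotheses.VariationalHodgeQP`** (part XXVII's printed-carrier node of the cell's
dictionary; BINDER-OWNERS row b03's quasi-projective form): the line `padic-disc-transport` reduces the
variational Hodge conjecture on quasi-projective carriers to the p-adic image-algebraization bet (AMMN
2022 Conj. 1.3, `K₀`-form) and the arithmetic disc. [cite: AntieauMathewMorrowNikolaus2022, Conj. 1.3 and Thm. D]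
[cite: CharlesSchnell2014Notes, Conj. 11.3.1] -/
theorem variationalHodgeQP_of_padic : Ring2.Hypotheses.VariationalHodgeQP :=
  Ring2.Binders.variationalHodgeQP_iff_quasiProjectiveTotal.2
    fun _ _ _ f hf h𝒳 hirr hsm p A hA hs₀ s =>
      variationalHodge_quasiProjective_of_padic hP hS f hf h𝒳 hirr hsm p A hA hs₀ s

/-- **P ∧ S ⟹ `Ring2.Hypotheses.FlatSectionsAlgebraicQP`** (Charles–Schnell's Conj. 11.3.1 verbatim on its
printed carriers; BINDER-OWNERS row b04's quasi-projective form), through part XXVII's equivalence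
`flatSectionsAlgebraicQP_of_variationalHodgeQP` (global invariant cycle theorem, in the kernel).
[cite: CharlesSchnell2014Notes, Conj. 11.3.1 and Thm. 11.3.4] -/
theorem flatSectionsAlgebraicQP_of_padic : Ring2.Hypotheses.FlatSectionsAlgebraicQP :=
  Ring2.Hypotheses.flatSectionsAlgebraicQP_of_variationalHodgeQP (variationalHodgeQP_of_padic hP hS)

end Padic

end Summit.HodgeConjecture.HodgeConjecture.Theorems

end
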